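import Literature.NumberTheory.Automorphic.ArchInnerFormSemiregularCentralizerBlockExplicit   -- ★ p850499 (M-UNFOLD explicit, LH5-p02 (g3)): clause [8] — the tokens `eτ`, `ι` below; brings ★ `ArchLocalRelabelTransport`, ★ `EndoscopicEmbedding`
import Literature.NumberTheory.Automorphic.ArchTorusOrbitalFubiniSmooth                       -- ★ `coe_archPiEquivCM_symm_apply` (the matrix of `archPiEquivCM⁻¹ u`)
import Literature.NumberTheory.Rogawski1990.ArchSmoothAmbientLift                             -- ambient matrix currency (`Matrix.Norms.Operator` instances in scope of the letters)
import HarnessLib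

/-!
# (eM-SMOOTH): the block embedding `b ↦ archPiEquivCM⁻¹ (Pi.mulSingle w₀ (e_τ (ι (b, 1))))` of (M-UNFOLD) is the restriction of a SMOOTH (affine) map of the ambient matrix
# (Rogawski 1990 §4.3, §4.8 Case (a), §4.12; Platonov–Rapinchuk §2.3)

Topic `NumberTheory/Automorphic`; namespace `Literature.NumberTheory.Automorphic.UnitaryGroup`.  THEOREMS ONLY (no `def`, no instance, no notation, no axiom, no named fact,
no `sorry`).  Cell `pub/hodgecm-mathlib`, crux H413 (`stmt-HodgeConjecture-24833`), line LH3 (closer stub `stub_N9`, direct road), LETTER L1 `HcOrbitalFamiliesStatement` clause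
(I₂) at the real walls, ALL ORDERS — the last matrix-currency reading the (B∞) dress needs (seat F0P3a-p05 (g20), default announced 2026-09-02T08:58:20Z, unclaimed by the
(M-UNFOLD) owner LH5-p02 (g3) within the window); count-neutral.

THE MATHEMATICS.  (M-UNFOLD) ★ p850446∕p850499 (LH5-p02 (g3)) unfolds the centraliser `Z(s)` of a semi-regular chart point as `e : Z(s) ≃ₜ* B × K`, and its clause [8] reads the
inverse on `B × 1` as the BLOCK EMBEDDING `e⁻¹ (b, 1) = archPiEquivCM⁻¹ (Pi.mulSingle w₀ (e_{τ₀} (ι (b, 1))))` — `ι = endoEmb` the `{e₁,e₃}∣{e₂}` pattern (★ `EndoscopicEmbedding`: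
matrix `(a 0 b; 0 1 0; c 0 d)`), `e_{τ₀}` the relabelling by the permutation matrix `M(τ₀)` (★ `ArchLocalRelabelTransport`), `archPiEquivCM⁻¹ ∘ Pi.mulSingle w₀` the placement
at the place `w₀` (identity elsewhere; ★ `coe_archPiEquivCM_symm_apply`).  Read in the ambient algebra `M₃(L ⊗ ℝ)`, this is the restriction to `B` of the AFFINE map
`Λ(B) =` «`M(τ) · (B 0 0, 0, B 0 1; 0, 1, 0; B 1 0, 0, B 1 1) · M(τ)⁻¹` at `w₀`, `1` at `w ≠ w₀`» of the `2 × 2` matrix `B = ↑↑b` — smooth (`contDiff_blockPattern`, `contDiff_placeAt`,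
**`exists_contDiff_coe_symm_archPiEquivCM_mulSingle_relabel_endoEmb`**, stated for every permutation `τ`; clause [8] is the instance `τ := lineOf (formSign α w₀)`).
USE ((B∞) dress): with ★ (aM-SMOOTH) p850672 `(a′)_M^β = ΘM ∘ (↑↑·)` and [10] `e⁻¹ (1, k) = k`, the block test function of ★ (J-G′-BLOCK)∕(B) p850625 is
`b ↦ ΘM (Λ(↑↑b) · ↑↑(ρ c))`, i.e. `f (c, B) := ΘM (Λ B · ↑↑(ρ c))` is the smooth ambient `f` of ★ (A0-smooth) p850603 `contDiff_integral_prod_conj_hypBlockGL_half_param` (`ρ c` a chart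
point, smooth in `c` by ★ `contDiff_coe_gprimeTorus`).
HONEST LABEL: HC_CM is proved only modulo the printed citations (2 remaining named inputs: hLiu418 = `stmt-HodgeConjecture-24832`, h413 = `stmt-HodgeConjecture-24833`) until rung 0
closes; count-neutral matrix bookkeeping.

## References
* [Rogawski1990] J. D. Rogawski, *Automorphic Representations of Unitary Groups in Three Variables*, Ann. of Math. Stud. 123 (1990), §4.3 p. 43 (`G_∞ = Π_w G_w`), §4.8 Case (a) p. 53
  (the pattern `(* 0 *; 0 * 0; * 0 *)`), §4.12 Lemma 4.12.1 p. 66.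
* [PlatonovRapinchuk1994] V. Platonov, A. Rapinchuk, *Algebraic Groups and Number Theory* (1994), §2.3 (unitary groups of forms; block subgroups).
-/

set_option autoImplicit false

noncomputable section

open MeasureTheory Matrix NumberField NumberField.InfinitePlace NumberField.mixedEmbedding Set Function Topology Complex
open Literature.NumberTheory.Rogawski1990
open scoped MatrixGroups ContDiff Classical
open scoped Matrix.Norms.Operator

namespace Literature.NumberTheory.Automorphic.UnitaryGroup

section BlockEmbedding

variable (L : Type) [Field L] [NumberField L] [IsCMField L] (α : Fin 3 → L) (w₀ : {w : InfinitePlace L // IsComplex w}) (τ : Equiv.Perm (Fin 3))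

/-- **The `{e₁,e₃}∣{e₂}` block pattern with unit middle entry, on ALL `2 × 2` matrices** (the ambient extension of ★ `coe_coe_endoEmb_eq` at `(b, 1)`): affine, hence smooth.
[cite: Rogawski1990, §4.8 Case (a) p. 53] -/
theorem contDiff_blockPattern :
    ContDiff ℝ ∞ fun B : Matrix (Fin 2) (Fin 2) ℂ => (!![B 0 0, 0, B 0 1; 0, 1, 0; B 1 0, 0, B 1 1] : Matrix (Fin 3) (Fin 3) ℂ) := by
  let Λ : (Fin 3 → Fin 3 → ℂ) →L[ℝ] Matrix (Fin 3) (Fin 3) ℂ :=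
    LinearMap.toContinuousLinearMap (Matrix.ofLinearEquiv ℝ : (Fin 3 → Fin 3 → ℂ) ≃ₗ[ℝ] Matrix (Fin 3) (Fin 3) ℂ).toLinearMap
  have hΛ : ∀ f : Fin 3 → Fin 3 → ℂ, Λ f = Matrix.of f := fun _ => rfl
  have hentry : ∀ i j : Fin 2, ContDiff ℝ ∞ fun B : Matrix (Fin 2) (Fin 2) ℂ => B i j := fun i j =>
    (LinearMap.toContinuousLinearMap (Matrix.entryLinearMap ℝ ℂ i j)).contDiff
  have hfun : (fun B : Matrix (Fin 2) (Fin 2) ℂ => (!![B 0 0, 0, B 0 1; 0, 1, 0; B 1 0, 0, B 1 1] : Matrix (Fin 3) (Fin 3) ℂ)) =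
      fun B => Λ fun i j => (!![B 0 0, 0, B 0 1; 0, 1, 0; B 1 0, 0, B 1 1] : Matrix (Fin 3) (Fin 3) ℂ) i j := by
    funext B; rw [hΛ]; rfl
  rw [hfun]
  refine Λ.contDiff.comp (contDiff_pi.2 fun i => contDiff_pi.2 fun j => ?_)
  fin_cases i <;> fin_cases j
  · simpa using hentry 0 0
  · simpa using (contDiff_const : ContDiff ℝ ∞ fun _ : Matrix (Fin 2) (Fin 2) ℂ => (0 : ℂ))
  · simpa using hentry 0 1
  · simpa using (contDiff_const : ContDiff ℝ ∞ fun _ : Matrix (Fin 2) (Fin 2) ℂ => (0 : ℂ))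
  · simpa using (contDiff_const : ContDiff ℝ ∞ fun _ : Matrix (Fin 2) (Fin 2) ℂ => (1 : ℂ))
  · simpa using (contDiff_const : ContDiff ℝ ∞ fun _ : Matrix (Fin 2) (Fin 2) ℂ => (0 : ℂ))
  · simpa using hentry 1 0
  · simpa using (contDiff_const : ContDiff ℝ ∞ fun _ : Matrix (Fin 2) (Fin 2) ℂ => (0 : ℂ))
  · simpa using hentry 1 1

omit [IsCMField L] in
/-- **Placing a `3 × 3` complex matrix at the place `w₀` (identity elsewhere) inside `M₃(L ⊗ ℝ)` is smooth** — the ambient reading of `archPiEquivCM⁻¹ ∘ Pi.mulSingle w₀`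
(★ `coe_archPiEquivCM_symm_apply`). [cite: Rogawski1990, §4.3 p. 43] -/
theorem contDiff_placeAt :
    ContDiff ℝ ∞ fun X : Matrix (Fin 3) (Fin 3) ℂ =>
      (Matrix.of fun i j : Fin 3 => ((0 : {w : InfinitePlace L // IsReal w} → ℝ),
        fun w : {w : InfinitePlace L // IsComplex w} => if w = w₀ then X i j else (1 : Matrix (Fin 3) (Fin 3) ℂ) i j) : Matrix (Fin 3) (Fin 3) (mixedSpace L)) := by
  let Λ : (Fin 3 → Fin 3 → mixedSpace L) →L[ℝ] Matrix (Fin 3) (Fin 3) (mixedSpace L) :=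
    LinearMap.toContinuousLinearMap (Matrix.ofLinearEquiv ℝ : (Fin 3 → Fin 3 → mixedSpace L) ≃ₗ[ℝ] Matrix (Fin 3) (Fin 3) (mixedSpace L)).toLinearMap
  have hΛ : ∀ f : Fin 3 → Fin 3 → mixedSpace L, Λ f = Matrix.of f := fun _ => rfl
  have hentry : ∀ i j : Fin 3, ContDiff ℝ ∞ fun X : Matrix (Fin 3) (Fin 3) ℂ => X i j := fun i j =>
    (LinearMap.toContinuousLinearMap (Matrix.entryLinearMap ℝ ℂ i j)).contDiff
  show ContDiff ℝ ∞ fun X : Matrix (Fin 3) (Fin 3) ℂ => Λ fun i j => ((0 : {w : InfinitePlace L // IsReal w} → ℝ),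
    fun w : {w : InfinitePlace L // IsComplex w} => if w = w₀ then X i j else (1 : Matrix (Fin 3) (Fin 3) ℂ) i j)
  refine Λ.contDiff.comp (contDiff_pi.2 fun i => contDiff_pi.2 fun j => contDiff_const.prodMk (contDiff_pi.2 fun w => ?_))
  by_cases hw : w = w₀
  · simp only [hw, if_true]; exact hentry i j
  · simp only [hw, if_false]; exact contDiff_const

/-- **(eM-SMOOTH) — THE BLOCK EMBEDDING OF (M-UNFOLD) IS THE RESTRICTION OF A SMOOTH MAP OF THE AMBIENT MATRIX.**  For the block form `diag(α(τ0), α(τ2))` at the place `w₀`,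
the relabelling `e_τ = restrictSubgroup (conjEquiv M(τ))` (★ `ArchLocalRelabelTransport`) and the endoscopic embedding `ι = endoEmb` of the `{e₁,e₃}∣{e₂}` pattern for `α ∘ τ`
(★ `EndoscopicEmbedding`), there is a `C^∞` map `Λ : M₂(ℂ) → M₃(L ⊗ ℝ)` with
**`↑↑(archPiEquivCM⁻¹ (Pi.mulSingle w₀ (e_τ (ι (b, 1))))) = Λ (↑↑b)` for every `b ∈ U(σ_{w₀} diag(α(τ0), α(τ2)))(ℂ)`** — `Λ(B) =` «`M(τ) · (B 0 0, 0, B 0 1; 0, 1, 0; B 1 0, 0, B 1 1) · M(τ)⁻¹`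
at `w₀`, `1` at the other places» (affine in `B`).  With `τ := lineOf (formSign α w₀)` this is EXACTLY clause [8] of ★ p850499's `e⁻¹ (b, 1)`, so the block test function
`b ↦ (a′)_M^β (e⁻¹ (b, r))` of ★ (J-G′-BLOCK)∕(B) reads `ΘM (Λ ↑↑b · ↑↑r)` with `ΘM` smooth (★ (aM-SMOOTH) p850672) — the `hf`∕`hFf` input of ★ (A0-smooth) p850603 for the (B∞) dress.
[cite: Rogawski1990, §4.3 p. 43; §4.8 Case (a) p. 53; §4.12 Lemma 4.12.1 p. 66] [cite: PlatonovRapinchuk1994, §2.3] -/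
theorem exists_contDiff_coe_symm_archPiEquivCM_mulSingle_relabel_endoEmb :
    ∃ Λ : Matrix (Fin 2) (Fin 2) ℂ → Matrix (Fin 3) (Fin 3) (mixedSpace L), ContDiff ℝ ∞ Λ ∧
      ∀ b : ↥(unitaryGroupOfForm (starRingEnd ℂ) ((Matrix.diagonal ![(α ∘ τ) 0, (α ∘ τ) 2]).map w₀.1.embedding)),
        ((((archPiEquivCM 3 L (Matrix.diagonal α)).symm (Pi.mulSingle w₀
            ((ContinuousMulEquiv.restrictSubgroup
              (GLn.conjEquiv (Matrix.GeneralLinearGroup.mkOfDetNeZero _ (det_monomial_one_ne_zero 3 τ)))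
              (archLocal L 3 (Matrix.diagonal (α ∘ τ)) w₀) (archLocal L 3 (Matrix.diagonal α) w₀)
              (mem_archLocal_comp_perm_iff_conj_mem L 3 α w₀ τ))
              ((endoEmb (starRingEnd ℂ) ((Matrix.diagonal ![(α ∘ τ) 0, (α ∘ τ) 2]).map w₀.1.embedding)
                ((Matrix.diagonal ![(α ∘ τ) 1]).map w₀.1.embedding) ((Matrix.diagonal (α ∘ τ)).map w₀.1.embedding)
                (endoForm_archLocal_diagonal L (α ∘ τ) w₀)) (b, 1)))) :
            ↥(arch (↥(maximalRealSubfield L)) L (IsCMField.complexConj L) 3 (Matrix.diagonal α))) : GL (Fin 3) (mixedSpace L)) :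
          Matrix (Fin 3) (Fin 3) (mixedSpace L)) = Λ (((b : GL (Fin 2) ℂ)) : Matrix (Fin 2) (Fin 2) ℂ) := by
  obtain ⟨T, hT⟩ : ∃ T : GL (Fin 3) ℂ, T = Matrix.GeneralLinearGroup.mkOfDetNeZero _ (det_monomial_one_ne_zero 3 τ) := ⟨_, rfl⟩
  obtain ⟨P, hP⟩ : ∃ P : Matrix (Fin 3) (Fin 3) ℂ → Matrix (Fin 3) (Fin 3) (mixedSpace L), P = fun X =>
      Matrix.of fun i j : Fin 3 => ((0 : {w : InfinitePlace L // IsReal w} → ℝ),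
        fun w : {w : InfinitePlace L // IsComplex w} => if w = w₀ then X i j else (1 : Matrix (Fin 3) (Fin 3) ℂ) i j) := ⟨_, rfl⟩
  obtain ⟨Q, hQ⟩ : ∃ Q : Matrix (Fin 2) (Fin 2) ℂ → Matrix (Fin 3) (Fin 3) ℂ, Q = fun B =>
      (T : Matrix (Fin 3) (Fin 3) ℂ) * (!![B 0 0, 0, B 0 1; 0, 1, 0; B 1 0, 0, B 1 1] : Matrix (Fin 3) (Fin 3) ℂ) *
        ((T⁻¹ : GL (Fin 3) ℂ) : Matrix (Fin 3) (Fin 3) ℂ) := ⟨_, rfl⟩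
  have hPc : ContDiff ℝ ∞ P := by rw [hP]; exact contDiff_placeAt L w₀
  have hQc : ContDiff ℝ ∞ Q := by rw [hQ]; exact (contDiff_const.mul contDiff_blockPattern).mul contDiff_const
  refine ⟨fun B => P (Q B), hPc.comp hQc, fun b => ?_⟩
  rw [coe_archPiEquivCM_symm_apply, hP]
  congr 1
  funext i j
  congr 1
  funext w
  by_cases hw : w = w₀
  · subst hw
    have h1 : ((((1 : ↥(unitaryGroupOfForm (starRingEnd ℂ) ((Matrix.diagonal ![(α ∘ τ) 1]).map w.1.embedding))) : GL (Fin 1) ℂ) : Matrix (Fin 1) (Fin 1) ℂ) 0 0) = 1 := by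
      rw [OneMemClass.coe_one, Units.val_one, Matrix.one_apply_eq]
    rw [if_pos rfl, Pi.mulSingle_eq_same, ContinuousMulEquiv.coe_restrictSubgroup_apply, GLn.conjEquiv_apply, Units.val_mul, Units.val_mul, coe_endoEmb,
      coe_endoGL_eq, h1, hQ, hT]
  · rw [if_neg hw, Pi.mulSingle_eq_of_ne hw, OneMemClass.coe_one, Units.val_one]

end BlockEmbedding

end Literature.NumberTheory.Automorphic.UnitaryGroup

end
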